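import Summits.HodgeConjecture.HodgeConjecture.Theorems.NikulinTwinTransportLefschetzOneOneK3Assembly
import Literature.AlgebraicGeometry.HodgeTheory.LefschetzOneOneCechIntegrality
import Literature.AlgebraicGeometry.HodgeTheory.ChernCharacterClass
import Literature.AlgebraicGeometry.HodgeTheory.HodgeFiltrationModels
import Literature.Geometry.Kaehler.HolomorphicLineBundleChernConnection

/-!
# Route NikulinTwinTransport — `LefschetzOneOneK3`: the analytic Lefschetz `(1,1)` theorem, and the K-theoretic closure

Helper file (`--supports stmt-HodgeConjecture-13678`) for the route item `LefschetzOneOneK3`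
(Lefschetz `(1,1)` for the projective K3 surfaces of the route, the K3 slice of the named fact
`lefschetzOneOne_rational`). With the Čech integrality step (Z) DISCHARGED
(`Literature.AlgebraicGeometry.HodgeTheory.CechCocycleIntegral_holds`), the tree's reductions leave the
meromorphic-section lemma of Voisin I, Cor. 11.34 as the only input of the item
(`lefschetzOneOneK3_of_globalSections`) and of the named fact (`lefschetzOneOne_rational_of_isTrivialOn`).
This file then records the K-THEORETIC reading of the Chern–Weil heart, through the Chern connection
of a Hermitian holomorphic line cocycle (`Literature/Geometry/Kaehler/HolomorphicLineBundleChernConnection`: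
a Chern form of `(L, h)` is a first Chern character form, `ch₁ = c₁`) and the Chern character CLASS
`HodgeModel.chernCharacter` (`ChernCharacterClass`, Chern–Weil I–II proved):

* `exists_eq_smul_chernCharacter_lineBundle` — **UNCONDITIONAL analytic Lefschetz `(1,1)`: on a
  smooth projective `X/ℂ`, every rational class of type `(1,1)` is a complex multiple of the first
  Chern class `c₁(L) = A.chernCharacter L.toSmoothCocycle 1` of ONE holomorphic line bundle `L` on
  `X^an`** (Voisin I, Thm. 11.30: `Hdg²(X, ℤ) = c₁(Pic X)`, with Thm. 7.10 (i)), hence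
  (`mem_span_holomorphicBundleChernCharacter_one`) lies in the `ℂ`-span of
  `HodgeModel.holomorphicBundleChernCharacter A 1` — the degree-`2` instance of the hypothesis of the
  K-theoretic reformulation `hodgeConjectureFor_of_span_le` (Deligne, Clay §2 (ii));
* `lefschetzOneOneK3_of_chernClass_lineBundle_algebraic` — **the item from the algebraicity of `c₁`
  of holomorphic LINE bundles on Hodge models of the item's surfaces** (the residual input in its
  sharpest form: GAGA for line bundles, Serre 1956 n° 20 Prop. 18, with `c₁(𝒪(D)) = [D]`, Voisin I
  Thm. 11.33);
* `lefschetzOneOneK3_of_span_chernCharacter_le`, `lefschetzOneOne_rational_of_span_chernCharacter_le`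
  — the item, and the named fact in all dimensions, from the degree-`2` slice of Voisin I, Thm. 11.32 ⊆
  (the named fact `span_holomorphicBundleChernCharacter_le_algebraicClasses` of
  `HolomorphicBundleChernCharacterSplit`).

So the item's trust base is now ONE statement, in either of the equivalent spellings
{Cor. 11.34's sections} / {`c₁` of holomorphic line bundles is algebraic} / {Thm. 11.32 ⊆ in degree 2},
all GAGA in content and absent from the tree.
-/

noncomputable section

namespace Summit.HodgeConjecture.HodgeConjecture.Theorems

open scoped Manifold ContDiff
open Literature.Geometry.Kaehler
open Literature.NumberTheory.Transcendental (complexDeRhamCohomology mem_cclosedSmoothForms)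
open Literature.AlgebraicGeometry
open Literature.AlgebraicGeometry.HodgeTheory
open Literature.AlgebraicTopology.SingularHomology (singularCohomology)
open Summit.HodgeConjecture.HodgeConjecture.Theses.NikulinTwinTransport

variable {n : ℕ} {X : Motives.SchemeOver ℂ}

/-! ### The post-(Z) state of the item: the Kodaira–Serre sections alone -/

/-- **`LefschetzOneOneK3` from the Kodaira–Serre sections on Hodge models of the item's surfaces
ALONE** — the Čech integrality input (Z) being discharged (`CechCocycleIntegral_holds`): the residual
input is the meromorphic-section lemma of Voisin I, Cor. 11.34 in its K3-local sections form.
[cite: VoisinHodgeI2002, Thm. 11.30 and Cor. 11.34] -/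
theorem lefschetzOneOneK3_of_globalSections
    (h₂ : ∀ ⦃S : Motives.SchemeOver ℂ⦄,
      (Motives.IsSmoothProjective 2 S ∧ Subsingleton (Motives.structureSheafCohomology S.left 1) ∧
        ∃ (A : HodgeModel 2 S) (η : MForm 𝓘(ℝ, A.model) A.carrier ℂ 2),
          Literature.Geometry.Kaehler.IsHolomorphicInCharts η ∧ ∀ x, η x ≠ 0) →
      ∀ (A : HodgeModel 2 S) (ι : Type) (L : HolomorphicLineBundle ι A.model A.carrier),
        ∃ (κ : Type) (L' : HolomorphicLineBundle κ A.model A.carrier)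
          (σ₁ : (L.tensor L').GlobalSection) (σ₂ : L'.GlobalSection),
          σ₁.zeroSet ≠ Set.univ ∧ σ₂.zeroSet ≠ Set.univ) :
    LefschetzOneOneK3 :=
  lefschetzOneOneK3_of_cechIntegral_of_globalSections CechCocycleIntegral_holds h₂

/-- **The named fact `lefschetzOneOne_rational` from the meromorphic-section lemma of Cor. 11.34
ALONE** (every cocycle holomorphic line bundle on a Hodge model of a smooth projective variety is
trivial off a proper closed analytic subset), (Z) being discharged.
[cite: VoisinHodgeI2002, Thm. 11.30, Cor. 11.34 and §11.3.2] -/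
theorem lefschetzOneOne_rational_of_isTrivialOn
    (h₂ : ∀ ⦃n : ℕ⦄ ⦃X : Motives.SchemeOver ℂ⦄, Motives.IsSmoothProjective n X →
      ∀ (A : HodgeModel n X) (ι : Type) (L : HolomorphicLineBundle ι A.model A.carrier),
      ∃ S : Set A.carrier, Literature.Geometry.Kaehler.IsAnalyticSet 𝓘(ℂ, A.model) S ∧
        S ≠ Set.univ ∧ L.IsTrivialOn Sᶜ) :
    lefschetzOneOne_rational :=
  lefschetzOneOne_rational_of_cechIntegral_of_isTrivialOn CechCocycleIntegral_holds h₂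

/-! ### The analytic Lefschetz `(1,1)` theorem: rational `(1,1)`-classes are multiples of `c₁(L)` -/

/-- **The first Chern class `c₁(L) = ch₁(L) = A.chernCharacter L.toSmoothCocycle 1` of a holomorphic
line cocycle is computed by any Chern form of any Hermitian metric**: `A.pullback (c₁(L)) = A.deRham[θ]`
(Voisin I, Thm. 7.10 (i): "the class of the Chern form `ω_{L,h}` is the image of `c₁(L)`"; Chern–Weil
II, `HodgeModel.pullback_chernCharacter`, with `θ = ch₁(L, D_h)` for the Chern connection,
`HermitianMetric.isChernCharacterForm_of_isChernForm`).
[cite: VoisinHodgeI2002, Thm. 7.10 (i)] [cite: Kobayashi1987, Ch. II §2 Thm. 2.16] -/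
theorem pullback_chernCharacter_toSmoothCocycle_of_isChernForm (A : HodgeModel n X) {ι : Type}
    (L : HolomorphicLineBundle ι A.model A.carrier) (h : L.HermitianMetric)
    (θ : MForm 𝓘(ℝ, A.model) A.carrier ℂ 2) (hs : IsSmoothForm θ) (hc : IsClosedForm θ)
    (hθ : h.IsChernForm θ) :
    A.pullback (2 * 1) (A.chernCharacter L.toSmoothCocycle 1) =
      A.deRham A.carrier (2 * 1)
        (complexDeRhamCohomology.mk A.model A.carrier (2 * 1) ⟨θ, mem_cclosedSmoothForms hs hc⟩) :=
  A.pullback_chernCharacter L.toSmoothCocycle 1 h.chernConnection hs hc (h.isChernCharacterForm_of_isChernForm hθ)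

/-- **Lefschetz's theorem on `(1,1)`-classes, analytic form (unconditional): a rational `(1,1)`-class
is a complex multiple of the first Chern class of ONE holomorphic line bundle.** For `X` smooth
projective over `ℂ`, a Hodge model `A` and a RATIONAL class `c ∈ H²(X(ℂ); ℂ)` whose pull-back lies in
`A.hodgePQ 2 1 1`, there are a holomorphic line cocycle `L` on `A.carrier ≅ X^an` and `a : ℂ` with
`c = a • A.chernCharacter L.toSmoothCocycle 1` (`= a • c₁(L)`). Proof: `N • c` is integral (universal
coefficients); by the Chern–Weil heart for de Rham's comparison (`deRhamLefschetzOneOne_of_cechIntegral`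
fed with the discharged Čech integrality step `CechCocycleIntegral_holds`) transported to `A` by
rigidity (`lefschetzOneOne_chernWeil_of_rigidity`, `NaturalDeRhamComparisonRigidity_holds`),
`A.pullback (N • c) = μ • A.deRham[θ]` for the Chern form `θ` of some `(L, h)`, and
`A.deRham[θ] = A.pullback (c₁(L))` (`pullback_chernCharacter_toSmoothCocycle_of_isChernForm`),
`A.pullback` being injective. Voisin I, Thm. 11.30: "`Hdg²(X, ℤ)` is equal to the image of
`c₁ : Pic X → H²(X, ℤ)`", here tensored with `ℂ`. [cite: VoisinHodgeI2002, Thm. 11.30 and Thm. 7.10 (i)] -/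
theorem exists_eq_smul_chernCharacter_lineBundle (hX : Motives.IsSmoothProjective n X) (A : HodgeModel n X)
    (c : complexBetti X (2 * 1)) (hc : IsRationalClass c) (h11 : A.pullback (2 * 1) c ∈ A.hodgePQ (2 * 1) 1 1) :
    ∃ (ι : Type) (L : HolomorphicLineBundle ι A.model A.carrier) (a : ℂ),
      c = a • A.chernCharacter L.toSmoothCocycle 1 := by
  obtain ⟨N, hN, hNc⟩ := exists_nsmul_isIntegralClass_of_isRationalClass_holds hX (2 * 1) c hc
  have hβi : IsIntegralClass (A.pullback (2 * 1) ((N : ℂ) • c)) := hNc.map _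
  have hβ11 : A.pullback (2 * 1) ((N : ℂ) • c) ∈ A.hodgePQ (2 * 1) 1 1 := by
    rw [map_smul]
    exact Submodule.smul_mem _ _ h11
  obtain ⟨ι, L, h, θ, hs, hcl, hθ, μ, hβ⟩ :=
    lefschetzOneOne_chernWeil_of_rigidity NaturalDeRhamComparisonRigidity_holds
      (fun E _ _ _ ↦ deRhamLefschetzOneOne_of_cechIntegral CechCocycleIntegral_holds E)
      (fun _ _ _ _ _ _ _ _ _ _ _ _ _ _ _ _ ↦ inferInstance) hX A _ hβi hβ11
  have hN' : (N : ℂ) ≠ 0 := by exact_mod_cast hN.ne'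
  -- `A.pullback (N • c) = μ • A.pullback (c₁(L))`, and `A.pullback` is injective
  have hNc' : (N : ℂ) • c = μ • A.chernCharacter L.toSmoothCocycle 1 := A.pullback_injective (2 * 1)
    (by rw [hβ, map_smul, pullback_chernCharacter_toSmoothCocycle_of_isChernForm A L h θ hs hcl hθ])
  exact ⟨ι, L, (N : ℂ)⁻¹ * μ, by rw [mul_smul, ← hNc', smul_smul, inv_mul_cancel₀ hN', one_smul]⟩

/-- The same for classes of Hodge type `(1,1)` in the `∃`-over-models sense of `IsOfHodgeType`: the
line bundle lives on the model witnessing the type. [cite: VoisinHodgeI2002, Thm. 11.30] -/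
theorem exists_eq_smul_chernCharacter_lineBundle_of_isOfHodgeType (hX : Motives.IsSmoothProjective n X)
    (c : complexBetti X (2 * 1)) (hc : IsRationalClass c) (h11 : IsOfHodgeType n X (2 * 1) 1 1 c) :
    ∃ (A : HodgeModel n X) (ι : Type) (L : HolomorphicLineBundle ι A.model A.carrier) (a : ℂ),
      c = a • A.chernCharacter L.toSmoothCocycle 1 := by
  obtain ⟨A, hA⟩ := h11
  exact ⟨A, exists_eq_smul_chernCharacter_lineBundle hX A c hc hA⟩

/-- **Corollary (unconditional): a rational `(1,1)`-class is a `ℂ`-linear combination of first Chern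
characters of holomorphic bundles on `X^an`** (`c ∈ span (A.holomorphicBundleChernCharacter 1)`) —
the degree-`2` instance of the hypothesis of the K-theoretic reformulation of the Hodge conjecture
(`hodgeConjectureFor_of_span_le`; Deligne, Clay §2 (ii)). [cite: VoisinHodgeI2002, Thm. 11.30] [cite: Deligne2000, §2 Remark (ii)] -/
theorem mem_span_holomorphicBundleChernCharacter_one (hX : Motives.IsSmoothProjective n X) (A : HodgeModel n X)
    (c : complexBetti X (2 * 1)) (hc : IsRationalClass c) (h11 : A.pullback (2 * 1) c ∈ A.hodgePQ (2 * 1) 1 1) :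
    c ∈ Submodule.span ℂ (A.holomorphicBundleChernCharacter 1) := by
  obtain ⟨ι, L, a, rfl⟩ := exists_eq_smul_chernCharacter_lineBundle hX A c hc h11
  exact Submodule.smul_mem _ _ (Submodule.subset_span
    (A.chernCharacter_mem_holomorphicBundleChernCharacter L.toSmoothCocycle_isHolomorphic 1))

/-! ### The item from the algebraicity of `c₁` of holomorphic line bundles -/

/-- **`LefschetzOneOneK3` from the algebraicity of the first Chern classes of holomorphic LINE bundles
on Hodge models of the item's surfaces** — the residual input of the route item in its sharpest
K-theoretic form: `c₁(L) ∈ algebraicClasses S 1` for every holomorphic line cocycle `L` on a Hodge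
model of a surface of the item (in content GAGA for line bundles, Serre 1956 n° 20 Prop. 18, with
`c₁(𝒪(D)) = [D]`, Voisin I Thm. 11.33 — not in the tree). [cite: VoisinHodgeI2002, Thm. 11.30 and Thm. 11.33]
[cite: SerreGAGA1956, n° 20 Prop. 18] -/
theorem lefschetzOneOneK3_of_chernClass_lineBundle_algebraic
    (hL : ∀ ⦃S : Motives.SchemeOver ℂ⦄,
      (Motives.IsSmoothProjective 2 S ∧ Subsingleton (Motives.structureSheafCohomology S.left 1) ∧
        ∃ (A : HodgeModel 2 S) (η : MForm 𝓘(ℝ, A.model) A.carrier ℂ 2),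
          Literature.Geometry.Kaehler.IsHolomorphicInCharts η ∧ ∀ x, η x ≠ 0) →
      ∀ (A : HodgeModel 2 S) (ι : Type) (L : HolomorphicLineBundle ι A.model A.carrier),
        A.chernCharacter L.toSmoothCocycle 1 ∈ algebraicClasses S 1) :
    LefschetzOneOneK3 := by
  intro S hS c hc h11
  obtain ⟨A, hA⟩ := h11
  obtain ⟨ι, L, a, rfl⟩ := exists_eq_smul_chernCharacter_lineBundle hS.1 A c hc hA
  exact Submodule.smul_mem _ _ (hL hS A ι L)

/-- **`LefschetzOneOneK3` from Voisin I, Thm. 11.32 ⊆ in degree `2`** (the `ℂ`-span of the first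
Chern characters of the holomorphic bundles on `X^an` consists of algebraic classes — the `p = 1`
slice of the named fact `span_holomorphicBundleChernCharacter_le_algebraicClasses`; Serre GAGA n° 20
Prop. 18 with Fulton Prop. 19.1.2 in content). [cite: VoisinHodgeI2002, Thm. 11.30 and Thm. 11.32] -/
theorem lefschetzOneOneK3_of_span_chernCharacter_le
    (hle : ∀ ⦃n : ℕ⦄ ⦃X : Motives.SchemeOver ℂ⦄, Motives.IsSmoothProjective n X →
      ∀ A : HodgeModel n X, Submodule.span ℂ (A.holomorphicBundleChernCharacter 1) ≤ algebraicClasses X 1) :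
    LefschetzOneOneK3 := by
  intro S hS c hc h11
  obtain ⟨A, hA⟩ := h11
  exact hle hS.1 A (mem_span_holomorphicBundleChernCharacter_one hS.1 A c hc hA)

/-- **The named fact `lefschetzOneOne_rational` from Voisin I, Thm. 11.32 ⊆ in degree `2`** (all
dimensions): the same K-theoretic closure. [cite: VoisinHodgeI2002, Thm. 11.30, Thm. 11.32 and §11.3.2] -/
theorem lefschetzOneOne_rational_of_span_chernCharacter_le
    (hle : ∀ ⦃n : ℕ⦄ ⦃X : Motives.SchemeOver ℂ⦄, Motives.IsSmoothProjective n X →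
      ∀ A : HodgeModel n X, Submodule.span ℂ (A.holomorphicBundleChernCharacter 1) ≤ algebraicClasses X 1) :
    lefschetzOneOne_rational := by
  intro n X hX c hc h11
  obtain ⟨A, hA⟩ := h11
  exact hle hX A (mem_span_holomorphicBundleChernCharacter_one hX A c hc hA)

end Summit.HodgeConjecture.HodgeConjecture.Theorems

end
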